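import Mathlib
import Literature.Probability.Percolation.KozmaNitzanGoodQuadruple
import Literature.Probability.Percolation.PercolationEvents
import HarnessLib

/-!
# `NoHeavyLowerTail` (stmt-CriticalPhenomena-4575), line fat-minority-linear — Kozma–Nitzan's
# Theorem 4 comparison and the post-FKG inequality ON EVERY UP-SET of the edges at `0`

Route task `nh-dp-fatminority` (gen 9).  `μ = prodBernoulli w` on the pairs of a finite vertex type,
`0 = o` an observer all of whose positive-weight pairs go to `A` ("`0` isolated in `G ∖ A`", as in
`KozmaNitzan2024_thm4_good`), `b` a target.

For a family `𝒰` of subsets of `A` which is an UP-SET inside `𝒫(A)` and does not contain `∅`, let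
`U = {ω : BondConfig V | ∃ B ∈ 𝒰, ∀ u ∈ B, s(o, u) ∈ ω} = {some B ∈ 𝒰 has all pairs 0–B open}` (an increasing event; under the star
decomposition it is the disjoint union of the stars `σ_B`, `B ∈ 𝒰`).  Then, with `a₀ ∈ A` minimising
`P_{G∖{0}}(a ↔ b)`:

* `upset_thm4_comparison` :  `μ({a₀ ↔ b} ∩ U) ≤ μ({0 ↔ b} ∩ U)`  (Lemma 5 summed over `B ∈ 𝒰`; the case
  `𝒰 = 𝒫(A) ∖ {∅}`, `U = {0 ↔ A}`, is the core inequality of Kozma–Nitzan's Theorem 4, p. 13–14);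
* `upset_postFKG` :  `min_{a∈A} μ(a ↔ b) · μ(U) ≤ μ(a₀ ↔ b) · μ(U) ≤ μ({0 ↔ b} ∩ U)`  (Harris), i.e.
  `P(0 ↔ b | U) ≥ min_{a ∈ A} P(a ↔ b)` for EVERY up-set `U ≠ ∅`-free of the states of the edges at `0` —
  the post-FKG inequality (Kozma–Nitzan Conjecture 1) for stars holds conditionally on any increasing
  information about the star of `0`, not only on `{0 ↔ A}`.

This is the `c = b` case ("(PF)") of the signed star inequality SQ of FINDINGS-fat-minority-gen8 §4 and the
anchor half of the QUT4 induction of gen 9 (FINDINGS-fat-minority-gen9): for any vertex `c`,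
`μ({0↔b} ∩ U) − μ({c↔b} ∩ U) ≥ μ(a₀↔b)·μ(U) − μ({c↔b} ∩ U)` (`upset_anchor_bound`).
No new definitions (the up-set event is written out as `{ω | ∃ B ∈ 𝒰, ∀ u ∈ B, s(o,u) ∈ ω}`).
-/

namespace Summit.CriticalPhenomena.PercolationContinuityZ3.Theorems

open MeasureTheory Set
open Literature.Probability.LatticeModels (prodBernoulli prodBernoulli_harris)
open Literature.Probability.Percolation

noncomputable section
open scoped Classical

variable {V : Type*} [Fintype V]

omit [Fintype V] in
/-- `{ω : BondConfig V | ∃ B ∈ 𝒰, ∀ u ∈ B, s(o, u) ∈ ω}` is an increasing event. [folklore] -/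
theorem isUpperSet_starUpEvent (o : V) (𝒰 : Finset (Finset V)) :
    IsUpperSet ({ω : BondConfig V | ∃ B ∈ 𝒰, ∀ u ∈ B, s(o, u) ∈ ω}) := by
  intro ω ω' hle hω
  obtain ⟨B, hB, hop⟩ := hω
  exact ⟨B, hB, fun u hu => hle (hop u hu)⟩

omit [Fintype V] in
/-- On the star `σ_B` with `B ∈ 𝒰` the event `{ω : BondConfig V | ∃ B ∈ 𝒰, ∀ u ∈ B, s(o, u) ∈ ω}` holds. [folklore] -/
theorem inter_starUpEvent_inter_starEvent_of_mem {o : V} {A : Finset V} (hoA : o ∉ A)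
    {𝒰 : Finset (Finset V)} (h𝒰A : 𝒰 ⊆ A.powerset) {B : Finset V} (hB : B ∈ 𝒰)
    (E : Set (BondConfig V)) :
    E ∩ {ω : BondConfig V | ∃ B ∈ 𝒰, ∀ u ∈ B, s(o, u) ∈ ω} ∩ starEvent o (↑B : Set V) = E ∩ starEvent o (↑B : Set V) := by
  ext ω
  constructor
  · rintro ⟨⟨hE, -⟩, hσ⟩
    exact ⟨hE, hσ⟩
  · rintro ⟨hE, hσ⟩
    refine ⟨⟨hE, B, hB, fun u hu => ?_⟩, hσ⟩
    have huA : u ∈ A := Finset.mem_powerset.1 (h𝒰A hB) hu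
    have huo : u ≠ o := fun h => hoA (h ▸ huA)
    exact ((mem_starEvent_iff o (↑B : Set V) ω).1 hσ u huo).2 (Finset.mem_coe.2 hu)

omit [Fintype V] in
/-- On a star `σ_B` with `B ⊆ A` outside the up-set `𝒰` the event `{ω : BondConfig V | ∃ B ∈ 𝒰, ∀ u ∈ B, s(o, u) ∈ ω}` fails: a member
`B' ∈ 𝒰` with all pairs `0–B'` open would satisfy `B' ⊆ B`, and `𝒰` is closed upwards in `𝒫(A)`.
[folklore] -/
theorem inter_starUpEvent_inter_starEvent_of_not_mem {o : V} {A : Finset V} (hoA : o ∉ A)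
    {𝒰 : Finset (Finset V)} (h𝒰A : 𝒰 ⊆ A.powerset)
    (hup : ∀ B ∈ 𝒰, ∀ B' ∈ A.powerset, B ⊆ B' → B' ∈ 𝒰)
    {B : Finset V} (hBA : B ∈ A.powerset) (hB : B ∉ 𝒰) (E : Set (BondConfig V)) :
    E ∩ {ω : BondConfig V | ∃ B ∈ 𝒰, ∀ u ∈ B, s(o, u) ∈ ω} ∩ starEvent o (↑B : Set V) = ∅ := by
  ext ω
  simp only [mem_inter_iff, mem_empty_iff_false, iff_false, not_and]
  intro hEU hσ
  obtain ⟨B', hB', hop⟩ := hEU.2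
  apply hB
  refine hup B' hB' B hBA fun u hu => ?_
  have huA : u ∈ A := Finset.mem_powerset.1 (h𝒰A hB') hu
  have huo : u ≠ o := fun h => hoA (h ▸ huA)
  exact Finset.mem_coe.1 (((mem_starEvent_iff o (↑B : Set V) ω).1 hσ u huo).1 (hop u hu))

/-- Star decomposition of an event intersected with `{ω : BondConfig V | ∃ B ∈ 𝒰, ∀ u ∈ B, s(o, u) ∈ ω}`: only the stars `σ_B`, `B ∈ 𝒰`,
contribute.  (`0` isolated in `G ∖ A`: the pairs from `0` out of `A` have weight `0`.) [folklore] -/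
theorem real_inter_starUpEvent_eq_sum (w : Sym2 V → unitInterval) (A : Finset V) (o : V)
    (hoA : o ∉ A) (hiso : ∀ u, u ≠ o → u ∉ A → w s(o, u) = 0)
    (𝒰 : Finset (Finset V)) (h𝒰A : 𝒰 ⊆ A.powerset)
    (hup : ∀ B ∈ 𝒰, ∀ B' ∈ A.powerset, B ⊆ B' → B' ∈ 𝒰) (E : Set (BondConfig V)) :
    (prodBernoulli w).real (E ∩ {ω : BondConfig V | ∃ B ∈ 𝒰, ∀ u ∈ B, s(o, u) ∈ ω}) =
      ∑ B ∈ 𝒰, (prodBernoulli w).real (E ∩ starEvent o (↑B : Set V)) := by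
  rw [KNPreFKG.real_eq_sum_inter_starEvent w A o hoA hiso (E ∩ {ω : BondConfig V | ∃ B ∈ 𝒰, ∀ u ∈ B, s(o, u) ∈ ω})]
  have hz : ∀ B ∈ A.powerset, B ∉ 𝒰 →
      (prodBernoulli w).real (E ∩ {ω : BondConfig V | ∃ B ∈ 𝒰, ∀ u ∈ B, s(o, u) ∈ ω} ∩ starEvent o (↑B : Set V)) = 0 := by
    intro B hBA hB
    rw [inter_starUpEvent_inter_starEvent_of_not_mem hoA h𝒰A hup hBA hB, measureReal_empty]
  have hsub : ∑ B ∈ 𝒰, (prodBernoulli w).real (E ∩ {ω : BondConfig V | ∃ B ∈ 𝒰, ∀ u ∈ B, s(o, u) ∈ ω} ∩ starEvent o (↑B : Set V)) =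
      ∑ B ∈ A.powerset, (prodBernoulli w).real (E ∩ {ω : BondConfig V | ∃ B ∈ 𝒰, ∀ u ∈ B, s(o, u) ∈ ω} ∩ starEvent o (↑B : Set V)) :=
    Finset.sum_subset h𝒰A hz
  rw [← hsub]
  refine Finset.sum_congr rfl fun B hB => ?_
  rw [inter_starUpEvent_inter_starEvent_of_mem hoA h𝒰A hB]

/-- **Kozma–Nitzan's Theorem-4 comparison on every up-set.**  Let `0` be isolated in `G ∖ A`, `𝒰` an
up-set inside `𝒫(A)` with `∅ ∉ 𝒰`, `U = U`, and `a₀ ∈ A` a minimiser of `P_{G∖{0}}(a ↔ b)`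
(open path avoiding `0`).  Then `P(a₀ ↔ b, U) ≤ P(0 ↔ b, U)`.  Proof: decompose over the stars `σ_B`,
`B ∈ 𝒰` (`real_inter_starUpEvent_eq_sum`) and apply Lemma 5 (`KozmaNitzan2024_lemma5_fintype`) on each
(every `B ∈ 𝒰` is nonempty).  For `𝒰 = 𝒫(A) ∖ {∅}` this is the printed step "summing over all `B ≠ ∅`
gives `P(0↔b) ≥ P(a₀↔b, 0↔A)`". [cite: KozmaNitzan2024, Lemma 5 and proof of Thm. 4 (pp. 13–14)] -/
theorem upset_thm4_comparison (w : Sym2 V → unitInterval) (A : Finset V) (o b : V)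
    (hoA : o ∉ A) (hiso : ∀ u, u ≠ o → u ∉ A → w s(o, u) = 0)
    (𝒰 : Finset (Finset V)) (h𝒰A : 𝒰 ⊆ A.powerset)
    (hup : ∀ B ∈ 𝒰, ∀ B' ∈ A.powerset, B ⊆ B' → B' ∈ 𝒰) (h0 : ∅ ∉ 𝒰)
    {a₀ : V} (ha₀ : a₀ ∈ A)
    (hmin : ∀ v ∈ A, (prodBernoulli w).real (openConnIn ({o}ᶜ : Set V) a₀ b) ≤
      (prodBernoulli w).real (openConnIn ({o}ᶜ : Set V) v b)) :
    (prodBernoulli w).real (openConn a₀ b ∩ {ω : BondConfig V | ∃ B ∈ 𝒰, ∀ u ∈ B, s(o, u) ∈ ω}) ≤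
      (prodBernoulli w).real (openConn o b ∩ {ω : BondConfig V | ∃ B ∈ 𝒰, ∀ u ∈ B, s(o, u) ∈ ω}) := by
  rw [real_inter_starUpEvent_eq_sum w A o hoA hiso 𝒰 h𝒰A hup (openConn a₀ b),
    real_inter_starUpEvent_eq_sum w A o hoA hiso 𝒰 h𝒰A hup (openConn o b)]
  refine Finset.sum_le_sum fun B hB => ?_
  have hBne : B ≠ ∅ := fun h => h0 (h ▸ hB)
  obtain ⟨v, hv⟩ := Finset.nonempty_iff_ne_empty.2 hBne
  have hvA : v ∈ A := Finset.mem_powerset.1 (h𝒰A hB) hv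
  have hvo : v ≠ o := fun h => hoA (h ▸ hvA)
  have ha₀o : a₀ ≠ o := fun h => hoA (h ▸ ha₀)
  exact KozmaNitzan2024_lemma5_fintype w o b a₀ v (↑B : Set V) ha₀o hvo (Finset.mem_coe.2 hv)
    (hmin v hvA)

/-- **Post-FKG inequality on every up-set of the star of `0`.**  With `0` isolated in `G ∖ A`, `A ≠ ∅`,
and `U = U` for an up-set `𝒰 ⊆ 𝒫(A)` not containing `∅`:
`min_{a∈A} P(a ↔ b) · P(U) ≤ P(0 ↔ b, U)`, i.e. `P(0 ↔ b | U) ≥ min_{a∈A} P(a ↔ b)` whenever `P(U) > 0`.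
Proof: `upset_thm4_comparison` and Harris' inequality for the increasing events `{a₀ ↔ b}`, `U`, then
`P(a₀ ↔ b) ≥ min_a P(a ↔ b)`.  (`U = {0 ↔ A}` is Conjecture 1 of Kozma–Nitzan for `0` isolated in
`G ∖ A`, their corollary of Theorem 4.) [cite: KozmaNitzan2024, Thm. 4 (p. 12), Conjecture 1 (p. 3)] -/
theorem upset_postFKG (w : Sym2 V → unitInterval) (A : Finset V) (hA : A.Nonempty) (o b : V)
    (hoA : o ∉ A) (hiso : ∀ u, u ≠ o → u ∉ A → w s(o, u) = 0)
    (𝒰 : Finset (Finset V)) (h𝒰A : 𝒰 ⊆ A.powerset)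
    (hup : ∀ B ∈ 𝒰, ∀ B' ∈ A.powerset, B ⊆ B' → B' ∈ 𝒰) (h0 : ∅ ∉ 𝒰) :
    (A.inf' hA fun a => (prodBernoulli w).real (openConn a b)) *
        (prodBernoulli w).real ({ω : BondConfig V | ∃ B ∈ 𝒰, ∀ u ∈ B, s(o, u) ∈ ω}) ≤
      (prodBernoulli w).real (openConn o b ∩ {ω : BondConfig V | ∃ B ∈ 𝒰, ∀ u ∈ B, s(o, u) ∈ ω}) := by
  set μ := prodBernoulli w with hμ
  obtain ⟨a₀, ha₀, hmin⟩ :=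
    A.exists_min_image (fun a => μ.real (openConnIn ({o}ᶜ : Set V) a b)) hA
  have h1 := upset_thm4_comparison w A o b hoA hiso 𝒰 h𝒰A hup h0 ha₀ hmin
  have hH : μ.real (openConn a₀ b) * μ.real ({ω : BondConfig V | ∃ B ∈ 𝒰, ∀ u ∈ B, s(o, u) ∈ ω}) ≤
      μ.real (openConn a₀ b ∩ {ω : BondConfig V | ∃ B ∈ 𝒰, ∀ u ∈ B, s(o, u) ∈ ω}) :=
    prodBernoulli_harris w (isUpperSet_openConn a₀ b) (isUpperSet_starUpEvent o 𝒰)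
      MeasurableSet.of_discrete MeasurableSet.of_discrete
  have hinf : A.inf' hA (fun a => μ.real (openConn a b)) ≤ μ.real (openConn a₀ b) :=
    Finset.inf'_le _ ha₀
  have hU : 0 ≤ μ.real ({ω : BondConfig V | ∃ B ∈ 𝒰, ∀ u ∈ B, s(o, u) ∈ ω}) := measureReal_nonneg
  calc (A.inf' hA fun a => μ.real (openConn a b)) * μ.real ({ω : BondConfig V | ∃ B ∈ 𝒰, ∀ u ∈ B, s(o, u) ∈ ω})
      ≤ μ.real (openConn a₀ b) * μ.real ({ω : BondConfig V | ∃ B ∈ 𝒰, ∀ u ∈ B, s(o, u) ∈ ω}) := mul_le_mul_of_nonneg_right hinf hU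
    _ ≤ μ.real (openConn a₀ b ∩ {ω : BondConfig V | ∃ B ∈ 𝒰, ∀ u ∈ B, s(o, u) ∈ ω}) := hH
    _ ≤ μ.real (openConn o b ∩ {ω : BondConfig V | ∃ B ∈ 𝒰, ∀ u ∈ B, s(o, u) ∈ ω}) := h1

/-- **Anchor bound** (the `c`-form used by the QUT4 induction of gen 9): for ANY vertex `c`,
`P(0↔b, U) − P(c↔b, U) ≥ P(a₀↔b)·P(U) − P(c↔b, U)` with `a₀` the `G∖{0}`-minimiser over `A`; hence the
signed star inequality `P(0↔b,U) − P(c↔b,U) ≥ −(P(c↔b) − min_a P(a↔b))·P(U)` holds as soon as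
`P(c↔b | U) − P(c↔b) ≤ P(a₀↔b) − min_{a∈A} P(a↔b)` ("the boost of `c` from `U` is at most the slack of the
anchor"). [cite: KozmaNitzan2024, Lemma 5 (p. 13); this combination: route notes FINDINGS-fat-minority-gen9] -/
theorem upset_anchor_bound (w : Sym2 V → unitInterval) (A : Finset V) (o b c : V)
    (hoA : o ∉ A) (hiso : ∀ u, u ≠ o → u ∉ A → w s(o, u) = 0)
    (𝒰 : Finset (Finset V)) (h𝒰A : 𝒰 ⊆ A.powerset)
    (hup : ∀ B ∈ 𝒰, ∀ B' ∈ A.powerset, B ⊆ B' → B' ∈ 𝒰) (h0 : ∅ ∉ 𝒰)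
    {a₀ : V} (ha₀ : a₀ ∈ A)
    (hmin : ∀ v ∈ A, (prodBernoulli w).real (openConnIn ({o}ᶜ : Set V) a₀ b) ≤
      (prodBernoulli w).real (openConnIn ({o}ᶜ : Set V) v b)) :
    (prodBernoulli w).real (openConn a₀ b) * (prodBernoulli w).real ({ω : BondConfig V | ∃ B ∈ 𝒰, ∀ u ∈ B, s(o, u) ∈ ω}) -
        (prodBernoulli w).real (openConn c b ∩ {ω : BondConfig V | ∃ B ∈ 𝒰, ∀ u ∈ B, s(o, u) ∈ ω}) ≤
      (prodBernoulli w).real (openConn o b ∩ {ω : BondConfig V | ∃ B ∈ 𝒰, ∀ u ∈ B, s(o, u) ∈ ω}) -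
        (prodBernoulli w).real (openConn c b ∩ {ω : BondConfig V | ∃ B ∈ 𝒰, ∀ u ∈ B, s(o, u) ∈ ω}) := by
  have h1 := upset_thm4_comparison w A o b hoA hiso 𝒰 h𝒰A hup h0 ha₀ hmin
  have hH : (prodBernoulli w).real (openConn a₀ b) * (prodBernoulli w).real ({ω : BondConfig V | ∃ B ∈ 𝒰, ∀ u ∈ B, s(o, u) ∈ ω}) ≤
      (prodBernoulli w).real (openConn a₀ b ∩ {ω : BondConfig V | ∃ B ∈ 𝒰, ∀ u ∈ B, s(o, u) ∈ ω}) :=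
    prodBernoulli_harris w (isUpperSet_openConn a₀ b) (isUpperSet_starUpEvent o 𝒰)
      MeasurableSet.of_discrete MeasurableSet.of_discrete
  linarith

end

end Summit.CriticalPhenomena.PercolationContinuityZ3.Theorems
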